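import Literature.NumberTheory.GaloisRepresentations.LubinTateUnramifiedDisjoint
import HarnessLib

/-!
# `𝒪_E` is the integral closure of `𝒪_F` in `E`: it is free of rank `[E:F]` over `𝒪_F`, and the residue ring
# `𝒪_E/π𝒪_E` has `q^{[E:F]}` elements

Serre, *Local Fields* (1979), Ch. II §2 Prop. 3 ("`B` is the integral closure of `A` in `L` … free of rank `[L:K]`") and Ch. I §4 Prop. 10,
for a finite subextension `E ⊆ F̄` of a non-archimedean local field `F`, in the currency of the tree's Lubin–Tate files (`unitBall E` =
`{‖x‖ ≤ 1}` for the spectral norm, an `𝒪[F]`-algebra through `algInteger`).  Everything PROVED (0 sorry, no named facts), the module theory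
being Mathlib's `IsIntegralClosure.module_free` / `IsIntegralClosure.rank` / `IsIntegralClosure.finite` (PID base, separable extension):

* `isIntegral_iff_norm_le_one` — `x ∈ E` is integral over `𝒪_F` iff `‖x‖ ≤ 1` (the absolute integers are the closed unit ball);
* `isIntegralClosure_unitBall` — **`IsIntegralClosure (unitBall E) 𝒪[F] E`**; `isScalarTower_integer_unitBall`, `faithfulSMul_integer`;
* ★ `module_free_unitBall`, ★ `finrank_integer_unitBall` (**`finrank_{𝒪_F} 𝒪_E = [E:F]`**), `module_finite_unitBall` (separable `E/F`);
* ★ `natCard_quotient_span_pi` — **`|𝒪_E/π𝒪_E| = q^{[E:F]}`** (`ef = n`; `π𝒪_E = 𝔪_F·𝒪_E` is the image of `𝔪_F^{[E:F]}` under a basis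
  isomorphism `𝒪_E ≃ 𝒪_F^{[E:F]}`; `Ideal.piQuotEquiv`) — for `E ⊆ F^{nr}` the residue field of `E` has degree `[E:F]` over `𝓀_F`.

These are the inputs (F1)/(F2) named in `BRICK-C-NORM-g7.md` §4 for the exact order `p^N` of the cokernel of de Shalit's Theorem I.3.7, the
surjectivity of unramified traces and the unramified integral normal basis.

## References

* J.-P. Serre, *Local Fields* (1979), Ch. I §4 Prop. 10, Ch. II §2 Prop. 3. [SerreLocalFields1979]
* E. de Shalit, *Iwasawa theory of elliptic curves with complex multiplication* (1987), Ch. I §3.7 (`[k′:ℚ_p] = d`, `(𝒪_{k′}/p^N)(1)`). [deShalit1987]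
-/

noncomputable section

namespace Literature.NumberTheory.GaloisRepresentations

section UnitBallIntegralClosure

open GaloisRepresentations.IsNonarchimedeanLocalField LubinTate ValuativeRel Field

variable {F : Type} [Field F] [ValuativeRel F] [TopologicalSpace F] [IsNonarchimedeanLocalField F]

attribute [local instance] ltNormUniformSpace ltNormIsUniformAddGroup rk1 nF nE fintypeResidueField

variable (E : IntermediateField F (AlgebraicClosure F)) [FiniteDimensional F E]

/-! ### Integral elements are the elements of norm `≤ 1` -/

/-- **`x ∈ E` is integral over `𝒪_F` iff `‖x‖ ≤ 1`** (the integral closure of `𝒪_F` in `F̄` is the closed unit ball of the spectral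
norm). [cite: SerreLocalFields1979, Ch. II §2 Prop. 3] -/
theorem isIntegral_iff_norm_le_one (x : E) : IsIntegral 𝒪[F] x ↔ ‖x‖ ≤ 1 := by
  have hinj : Function.Injective ((IntermediateField.val E).restrictScalars 𝒪[F]) := fun a b h => Subtype.ext h
  rw [← isIntegral_algHom_iff ((IntermediateField.val E).restrictScalars 𝒪[F]) hinj, norm_coe_eq_algNorm,
    ← mem_absIntegers_iff_algNorm_le_one, absIntegers, mem_integralClosure_iff]
  rfl

/-- **`𝒪_E = unitBall E` is the integral closure of `𝒪_F` in `E`.** [cite: SerreLocalFields1979, Ch. II §2 Prop. 3] -/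
theorem isIntegralClosure_unitBall : IsIntegralClosure (unitBall E) 𝒪[F] E := by
  refine ⟨fun a b h => Subtype.ext h, fun {x} => ⟨fun hx => ?_, ?_⟩⟩
  · exact ⟨⟨x, (mem_unitBall_iff E).mpr ((isIntegral_iff_norm_le_one E x).mp hx)⟩, rfl⟩
  · rintro ⟨y, rfl⟩
    exact (isIntegral_iff_norm_le_one E _).mpr ((mem_unitBall_iff E).mp y.2)

/-- `𝒪_F → 𝒪_E → E` is a scalar tower. [cite: SerreLocalFields1979, Ch. II §2 Prop. 3] -/
theorem isScalarTower_integer_unitBall : IsScalarTower 𝒪[F] (unitBall E) E := by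
  refine IsScalarTower.of_algebraMap_eq fun a => ?_
  rw [IsScalarTower.algebraMap_apply 𝒪[F] F E]
  exact (algebraMap_integer_apply E a).symm

omit [TopologicalSpace F] [IsNonarchimedeanLocalField F] [FiniteDimensional F E] in
/-- `𝒪_F` acts faithfully on `E` (`𝒪_F → F → E` is injective). [cite: SerreLocalFields1979, Ch. II §2 Prop. 3] -/
theorem faithfulSMul_integer : FaithfulSMul 𝒪[F] E := by
  rw [faithfulSMul_iff_algebraMap_injective, IsScalarTower.algebraMap_eq 𝒪[F] F E, RingHom.coe_comp]
  exact (algebraMap F E).injective.comp (IsFractionRing.injective 𝒪[F] F)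

/-! ### `𝒪_E` is free of rank `[E:F]` over `𝒪_F` -/

/-- ★ **`𝒪_E` is a free `𝒪_F`-module** (integral closure of a PID in a finite separable extension).
[cite: SerreLocalFields1979, Ch. II §2 Prop. 3] -/
theorem module_free_unitBall [Algebra.IsSeparable F E] : Module.Free 𝒪[F] (unitBall E) := by
  haveI := isIntegralClosure_unitBall E
  haveI := isScalarTower_integer_unitBall E
  haveI := faithfulSMul_integer E
  exact IsIntegralClosure.module_free 𝒪[F] F E (unitBall E)

/-- ★ **`rank_{𝒪_F} 𝒪_E = [E:F]`.** [cite: SerreLocalFields1979, Ch. II §2 Prop. 3] -/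
theorem finrank_integer_unitBall [Algebra.IsSeparable F E] : Module.finrank 𝒪[F] (unitBall E) = Module.finrank F E := by
  haveI := isIntegralClosure_unitBall E
  haveI := isScalarTower_integer_unitBall E
  haveI := faithfulSMul_integer E
  exact IsIntegralClosure.rank 𝒪[F] F E (unitBall E)

/-- `𝒪_E` is a finite `𝒪_F`-module. [cite: SerreLocalFields1979, Ch. II §2 Prop. 3] -/
theorem module_finite_unitBall [Algebra.IsSeparable F E] : Module.Finite 𝒪[F] (unitBall E) := by
  haveI := isIntegralClosure_unitBall E
  haveI := isScalarTower_integer_unitBall E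
  haveI := faithfulSMul_integer E
  exact IsIntegralClosure.finite 𝒪[F] F E (unitBall E)

/-! ### The residue ring `𝒪_E/π𝒪_E` of an unramified `E` has `q^{[E:F]}` elements -/

variable {π : 𝒪[F]} (hπ : (valuation F).IsUniformizer (π : F))

omit [ValuativeRel F] [TopologicalSpace F] [IsNonarchimedeanLocalField F] [FiniteDimensional F E] in
/-- For a free module with basis indexed by a finite `ι`, the image of `I·M` under the coordinate isomorphism is `I^ι`.
[folklore] -/
private theorem map_toAddSubgroup_smul_top_eq {R M ι : Type*} [CommRing R] [AddCommGroup M] [Module R M] [Fintype ι] [DecidableEq ι]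
    (b : Module.Basis ι R M) (I : Ideal R) :
    (I • (⊤ : Submodule R M)).toAddSubgroup.map (b.equivFun : M ≃ₗ[R] (ι → R)).toAddEquiv.toAddMonoidHom =
      (Ideal.pi fun _ : ι => I).toAddSubgroup := by
  ext f
  simp only [AddSubgroup.mem_map, Submodule.mem_toAddSubgroup]
  constructor
  · rintro ⟨x, hx, rfl⟩
    change (b.equivFun x) ∈ Ideal.pi fun _ : ι => I
    rw [Ideal.mem_pi]
    intro i
    refine Submodule.smul_induction_on hx (fun r hr m _ => ?_) (fun x y hx hy => ?_)
    · rw [map_smul, Pi.smul_apply, smul_eq_mul]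
      exact I.mul_mem_right _ hr
    · rw [map_add, Pi.add_apply]
      exact I.add_mem hx hy
  · intro hf
    change f ∈ Ideal.pi fun _ : ι => I at hf
    rw [Ideal.mem_pi] at hf
    refine ⟨b.equivFun.symm f, ?_, b.equivFun.apply_symm_apply f⟩
    rw [Module.Basis.equivFun_symm_apply]
    exact Submodule.sum_mem _ fun i _ => Submodule.smul_mem_smul (hf i) Submodule.mem_top

include hπ in
/-- ★ **`|𝒪_E/π𝒪_E| = q^{[E:F]}`** for every finite separable `E` (`ef = n`): `π𝒪_E = 𝔪_F·𝒪_E` is carried by a basis isomorphism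
`𝒪_E ≃ 𝒪_F^{[E:F]}` onto `𝔪_F^{[E:F]}`, and `𝒪_F^{[E:F]}/𝔪_F^{[E:F]} ≃ 𝓀_F^{[E:F]}`; for `E ⊆ F^{nr}` (`π𝒪_E` maximal) this says that the
residue field of `E` has degree `[E:F]` over `𝓀_F`. [cite: SerreLocalFields1979, Ch. I §4 Prop. 10; Ch. II §2 Prop. 3] -/
theorem natCard_quotient_span_pi [Algebra.IsSeparable F E] :
    Nat.card (unitBall E ⧸ Ideal.span {algebraMap 𝒪[F] (unitBall E) π}) = residueFieldCard F ^ Module.finrank F E := by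
  classical
  haveI := module_free_unitBall E
  obtain ⟨b⟩ : Nonempty (Module.Basis (Fin (Module.finrank F E)) 𝒪[F] (unitBall E)) := by
    rw [← finrank_integer_unitBall E]
    haveI := module_finite_unitBall E
    exact ⟨Module.finBasis 𝒪[F] (unitBall E)⟩
  -- `π𝒪_E = 𝔪_F • 𝒪_E` as additive subgroups
  have hπm : π ∈ 𝓂[F] := by rw [maximalIdeal_eq_span_singleton hπ]; exact Ideal.mem_span_singleton_self π
  have hP : (Ideal.span {algebraMap 𝒪[F] (unitBall E) π}).toAddSubgroup = (𝓂[F] • (⊤ : Submodule 𝒪[F] (unitBall E))).toAddSubgroup := by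
    ext x
    simp only [Submodule.mem_toAddSubgroup]
    constructor
    · intro hx
      obtain ⟨y, rfl⟩ := Ideal.mem_span_singleton'.mp hx
      rw [mul_comm, ← Algebra.smul_def]
      exact Submodule.smul_mem_smul hπm Submodule.mem_top
    · intro hx
      refine Submodule.smul_induction_on hx (fun r hr m _ => ?_) (fun x y hx hy => Ideal.add_mem _ hx hy)
      obtain ⟨s, rfl⟩ := dvd_of_mem_maximalIdeal F hπ hr
      rw [Algebra.smul_def, map_mul, mul_assoc]
      exact Ideal.mul_mem_right _ _ (Ideal.mem_span_singleton_self _)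
  -- transport along the basis isomorphism
  have e1 : unitBall E ⧸ (Ideal.span {algebraMap 𝒪[F] (unitBall E) π}).toAddSubgroup ≃+
      (Fin (Module.finrank F E) → 𝒪[F]) ⧸ (Ideal.pi fun _ : Fin (Module.finrank F E) => 𝓂[F]).toAddSubgroup :=
    QuotientAddGroup.congr _ _ (b.equivFun : unitBall E ≃ₗ[𝒪[F]] (Fin (Module.finrank F E) → 𝒪[F])).toAddEquiv
      (by rw [hP]; exact map_toAddSubgroup_smul_top_eq b 𝓂[F])
  have e2 := (Ideal.piQuotEquiv (Fin (Module.finrank F E)) 𝓂[F]).toEquiv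
  calc Nat.card (unitBall E ⧸ Ideal.span {algebraMap 𝒪[F] (unitBall E) π})
      = Nat.card ((Fin (Module.finrank F E) → 𝒪[F]) ⧸ (Ideal.pi fun _ : Fin (Module.finrank F E) => 𝓂[F])) :=
        Nat.card_congr e1.toEquiv
    _ = Nat.card (Fin (Module.finrank F E) → 𝒪[F] ⧸ 𝓂[F]) := Nat.card_congr e2
    _ = residueFieldCard F ^ Module.finrank F E := by
        rw [Nat.card_fun, Nat.card_eq_fintype_card (α := Fin _), Fintype.card_fin]
        rfl

end UnitBallIntegralClosure

end Literature.NumberTheory.GaloisRepresentations
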